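import Literature.AlgebraicGeometry.HodgeTheory.BlochSemiregularityTheorem
import Literature.AlgebraicGeometry.HodgeTheory.ClassesSupportedOn
import Literature.AlgebraicGeometry.Motives.CompleteIntersection
import Literature.AlgebraicGeometry.Motives.ProjectiveClosedSetsForms
import HarnessLib

/-!
# Route AnchorTransport — `VariationalHodge` (stmt-HodgeConjecture-1076), line `polar-patch-broken-cycles`: the bet is implied by SEMIREGULAR REPRESENTATIVES

The registered bet of the line, `stub_semiregularBrokenRepresentative` (skeleton
`Cruxes/VariationalHodge/Lines/polar_patch_broken_cycles.lean`, §2b: every non-ambient rational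
`(2,2)` algebraic class on a smooth projective fourfold `X₀ ⊆ ℙᴺ` has, modulo ambient classes and up
to a non-zero rational multiple, a Bloch-semiregular BROKEN-CYCLE representative
`Z₀ = W₀ ∪ ⋃ⱼ Cⱼ` with its bookkeeping clauses), follows from the classical open problem of
SEMIREGULAR REPRESENTATIVES (Bloch, *Semi-regularity and de Rham cohomology*, Invent. Math. 17 (1972),
Remark (7.5): "The problem of constructing semi-regular representatives for algebraic cycle classes
of codimension `> 1` remains, however, wide open"), restricted to non-ambient classes on fourfolds:
take NO patch (`J = 0`), `Z₀ := W₀`, and for the transverse form `h` a coordinate `xⱼ` not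
vanishing at the image of a point of `W₀` (`Motives.exists_X_notMem`). The patch set is then empty
(`classesSupportedOn_empty`), the ideal clause is an `iInf` over `Fin 0`, purity and the component
clause follow from integrality of `W₀` (its generic point is the unique point whose image has
codimension `2`: `Order.coheight_add_one_le`) and from the non-ambient hypothesis. So the bet is
AT MOST as strong as Bloch's problem on fourfolds; the lead's analysis
(`Cruxes/VariationalHodge/Lines/polar-patch-broken-cycles-S1b-analysis-c2.md`, Theorem N) shows
that WITH a patch the semiregularity of `Z₀` is a `k`-free "G-relative" semiregularity of `W₀`, so
the bet sits between the two statements.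
-/

noncomputable section

-- every declaration of this problem lives in `Summit.HodgeConjecture.HodgeConjecture.…` (summit = sub-problem)
set_option linter.dupNamespace false

open CategoryTheory CategoryTheory.Limits AlgebraicGeometry TopologicalSpace
open Literature.AlgebraicGeometry.Motives Literature.AlgebraicGeometry.HodgeTheory
open Literature.AlgebraicGeometry.Deformation (conormalSheaf)

namespace Summit.HodgeConjecture.HodgeConjecture.Theorems

-- the grading of `ℂ[x₀,…,x_N]` by degree (as in `Motives/CompleteIntersection`), for `ProjectiveSpectrum.zeroLocus`
attribute [local instance] MvPolynomial.gradedAlgebra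

/-- **Semiregular representatives imply the line's bet** (`J = 0`): if every non-ambient rational
`(2,2)` algebraic class on a smooth projective fourfold `X₀ ⊆ ℙᴺ` has an integral lci codimension-`2`
BLOCH-SEMIREGULAR representative modulo ambient classes and up to `m ∈ ℚ ∖ 0` (Bloch 1972, Rem.
(7.5), restricted to fourfolds — the HYPOTHESIS, spelled out), then the registered stub
`stub_semiregularBrokenRepresentative` of the skeleton holds (the CONCLUSION, verbatim).
[cite: Bloch1972Semiregularity, Remark (7.5)] -/
theorem semiregularBrokenRepresentative_of_semiregularRepresentative :
    (∀ ⦃X₀ :SchemeOver ℂ⦄, IsSmoothProjective 4 X₀ → ∀ ⦃N :ℕ⦄ (φ :X₀ ⟶ projectiveSpace N ℂ), IsClosedImmersion φ.left → ∀ (a :complexBetti X₀ (2*2)), IsRationalClass a → IsOfHodgeType 4 X₀ (2*2) 2 2 a → a ∈ algebraicClasses X₀ 2 → (∀ (u :complexBetti (projectiveSpace N ℂ) (2*2)) (m :ℚ), m ≠ 0 → (m :ℂ) • a - complexBetti.map φ (2*2) u ≠ 0) → ∃ (W₀ :Scheme) (i₀ :W₀ ⟶ X₀.left) (_ :IsClosedImmersion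 i₀) (_ :IsIntegral W₀) (_ :IsFiniteLocallyFree (conormalSheaf i₀)) (_ :∀ w :W₀, (2 :ℕ∞) ≤ Order.coheight (i₀.base w)) (_ :∃ w :W₀, Order.coheight (i₀.base w) = 2) (m :ℚ) (_ :m ≠ 0) (u :complexBetti (projectiveSpace N ℂ) (2*2)), (m :ℂ) • a - complexBetti.map φ (2*2) u ∈ classesSupportedOn X₀ (Set.range i₀.base) (2*2) ∧ IsBlochSemiregular i₀ 4 2) → ∀ ⦃X₀ :SchemeOver ℂ⦄, IsSmoothProjective 4 X₀ → ∀ ⦃N :ℕ⦄ (φ :X₀ ⟶ projectiveSpace N ℂ), IsClosedImmersion φ.left → ∀ (a :complexBetti X₀ (2*2)), IsRationalClass a → IsOfHodgeType 4 X₀ (2*2) 2 2 a → a ∈ algebraicClasses X₀ 2 → (∀ (u :complexBetti (projectiveSpace N ℂ) (2*2)) (m :ℚ), m ≠ 0 → (m :ℂ) • a - complexBetti.map φ (2*2) u ≠ 0) → ∃ (W₀ :Scheme) (i₀ :W₀ ⟶ X₀.left) (_ :IsClosedImmersion i₀) (_ :IsIntegral W₀) (_ :IsFiniteLocallyFree (conormalSheaf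 i₀)) (_ :∀ w :W₀, (2 :ℕ∞) ≤ Order.coheight (i₀.base w)) (_ :∃ w :W₀, Order.coheight (i₀.base w) = 2) (m :ℚ) (_ :m ≠ 0) (u :complexBetti (projectiveSpace N ℂ) (2*2)) (_ :(m :ℂ) • a - complexBetti.map φ (2*2) u ∈ classesSupportedOn X₀ (Set.range i₀.base) (2*2)) (J k :ℕ) (d :Fin J → ℕ) (h :MvPolynomial (Fin (N+1)) ℂ) (q :Fin J → MvPolynomial (Fin (N+1)) ℂ) (_ :0 < k) (_ :∀ j, 0 < d j) (_ :h.IsHomogeneous k) (_ :∀ j, (q j).IsHomogeneous (d j)) (_ :∃ w :W₀, φ.left.base (i₀.base w) ∉ (ProjectiveSpectrum.zeroLocus (MvPolynomial.homogeneousSubmodule (Fin (N+1)) ℂ) {h} :Set (projectiveSpace N ℂ).left)) (_ :∀ (j :Fin J) (w :W₀), φ.left.base (i₀.base w) ∈ (ProjectiveSpectrum.zeroLocus (MvPolynomial.homogeneousSubmodule (Fin (N+1)) ℂ) {h} :Set (projectiveSpace N ℂ).left) → φ.left.base (i₀.base w) ∈ (ProjectiveSpectrum.zeroLocus (MvPolynomial.homogeneousSubmodule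 (Fin (N+1)) ℂ) {q j} :Set (projectiveSpace N ℂ).left)) (_ :∀ j :Fin J, IsIrreducible (φ.left.base ⁻¹' ((ProjectiveSpectrum.zeroLocus (MvPolynomial.homogeneousSubmodule (Fin (N+1)) ℂ) {h} :Set (projectiveSpace N ℂ).left) ∩ (ProjectiveSpectrum.zeroLocus (MvPolynomial.homogeneousSubmodule (Fin (N+1)) ℂ) {q j} :Set (projectiveSpace N ℂ).left)))) (_ :∀ (j :Fin J) (x :X₀.left), φ.left.base x ∈ (ProjectiveSpectrum.zeroLocus (MvPolynomial.homogeneousSubmodule (Fin (N+1)) ℂ) {h} :Set (projectiveSpace N ℂ).left) ∩ (ProjectiveSpectrum.zeroLocus (MvPolynomial.homogeneousSubmodule (Fin (N+1)) ℂ) {q j} :Set (projectiveSpace N ℂ).left) → (2 :ℕ∞) ≤ Order.coheight x) (_ :classesSupportedOn X₀ {x | φ.left.base x ∈ (ProjectiveSpectrum.zeroLocus (MvPolynomial.homogeneousSubmodule (Fin (N+1)) ℂ) {h} :Set (projectiveSpace N ℂ).left) ∧ ∃ j :Fin J, φ.left.base x ∈ (ProjectiveSpectrum.zeroLocus (MvPolynomial.homogeneousSubmodule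 (Fin (N+1)) ℂ) {q j} :Set (projectiveSpace N ℂ).left)} (2*2) ≤ LinearMap.range (complexBetti.map φ (2*2)).hom) (Z₀ :Scheme) (iZ :Z₀ ⟶ X₀.left) (_ :IsClosedImmersion iZ) (_ :IsFiniteLocallyFree (conormalSheaf iZ)) (_ :iZ.ker = i₀.ker ⊓ ⨅ j :Fin J, (pullback.snd (completeIntersectionι ![h, q j]).left φ.left).ker) (_ :Set.range iZ.base = Set.range i₀.base ∪ {x | φ.left.base x ∈ (ProjectiveSpectrum.zeroLocus (MvPolynomial.homogeneousSubmodule (Fin (N+1)) ℂ) {h} :Set (projectiveSpace N ℂ).left) ∧ ∃ j :Fin J, φ.left.base x ∈ (ProjectiveSpectrum.zeroLocus (MvPolynomial.homogeneousSubmodule (Fin (N+1)) ℂ) {q j} :Set (projectiveSpace N ℂ).left)}) (_ :∀ z :Z₀, ∃ z' :Z₀, Order.coheight (iZ.base z') = (2 :ℕ∞) ∧ iZ.base z' ⤳ iZ.base z) (_ :IsBlochSemiregular iZ 4 2), ∀ z :Z₀, Order.coheight (iZ.base z) = (2 :ℕ∞) → ∃ (μ :ℂ) (u' :complexBetti (projectiveSpace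 N ℂ) (2*2)), μ • a + complexBetti.map φ (2*2) u' ∈ classesSupportedOn X₀ (closure {iZ.base z}) (2*2) ∧ μ • a + complexBetti.map φ (2*2) u' ≠ 0 := by
  intro hSR X₀ hX₀ N φ hφ a ha hpp halg hna
  obtain ⟨W₀, i₀, hi₀, hint, hlci, hcod, hcod2, m, hm, u, hsupp, hsr⟩ := hSR hX₀ φ hφ a ha hpp halg hna
  haveI := hint
  obtain ⟨w₂, hw₂⟩ := hcod2
  -- a coordinate not vanishing at `φ (i₀ w₂)`
  obtain ⟨j, hj⟩ := Literature.AlgebraicGeometry.Motives.exists_X_notMem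
    (k := ℂ) (n := N) (φ.left.base (i₀.base w₂))
  have hnotin : φ.left.base (i₀.base w₂) ∉
      (ProjectiveSpectrum.zeroLocus (MvPolynomial.homogeneousSubmodule (Fin (N + 1)) ℂ) {MvPolynomial.X j} :
        Set (projectiveSpace N ℂ).left) := by
    intro hmem
    exact hj ((ProjectiveSpectrum.mem_zeroLocus _ _ _).1 hmem (Set.mem_singleton _))
  -- the empty patch set
  have hPempty : {x : X₀.left | φ.left.base x ∈
      (ProjectiveSpectrum.zeroLocus (MvPolynomial.homogeneousSubmodule (Fin (N + 1)) ℂ) {MvPolynomial.X j} :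
        Set (projectiveSpace N ℂ).left) ∧
      ∃ j' : Fin 0, φ.left.base x ∈
        (ProjectiveSpectrum.zeroLocus (MvPolynomial.homogeneousSubmodule (Fin (N + 1)) ℂ)
          {(Fin.elim0 j' : MvPolynomial (Fin (N + 1)) ℂ)} : Set (projectiveSpace N ℂ).left)} = ∅ := by
    ext x
    simp only [Set.mem_setOf_eq, Set.mem_empty_iff_false, iff_false, not_and, not_exists]
    exact fun _ j' => j'.elim0
  -- the generic point of `W₀` is the unique point whose image has codimension `2`
  have hgen : ∀ z : W₀, Order.coheight (i₀.base z) = (2 : ℕ∞) → ∀ w : W₀, i₀.base z ⤳ i₀.base w := by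
    intro z hz w
    have hξz : i₀.base (genericPoint W₀) ⤳ i₀.base z :=
      (genericPoint_specializes z).map i₀.base.hom.continuous
    have hξw : i₀.base (genericPoint W₀) ⤳ i₀.base w :=
      (genericPoint_specializes w).map i₀.base.hom.continuous
    have hle : i₀.base z ≤ i₀.base (genericPoint W₀) := hξz
    have hge : i₀.base (genericPoint W₀) ≤ i₀.base z := by
      by_contra hcon
      have hlt : i₀.base z < i₀.base (genericPoint W₀) := lt_of_le_not_ge hle hcon
      have h1 := Order.coheight_add_one_le hlt
      rw [hz] at h1
      have h2 : (2 : ℕ∞) ≤ Order.coheight (i₀.base (genericPoint W₀)) := hcod _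
      have hc : Order.coheight (i₀.base (genericPoint W₀)) ≠ ⊤ := by
        intro htop
        rw [htop, top_add] at h1
        exact absurd h1 (by simp)
      obtain ⟨c, hceq⟩ := ENat.ne_top_iff_exists.1 hc
      rw [← hceq] at h1 h2
      norm_cast at h1 h2
      omega
    have hzξ : i₀.base z ⤳ i₀.base (genericPoint W₀) := hge
    exact hzξ.trans hξw
  have hcodξ : Order.coheight (i₀.base (genericPoint W₀)) = (2 : ℕ∞) := by
    refine le_antisymm ?_ (hcod _)
    have hle : i₀.base w₂ ≤ i₀.base (genericPoint W₀) :=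
      (genericPoint_specializes w₂).map i₀.base.hom.continuous
    exact hw₂ ▸ Order.coheight_anti hle
  refine ⟨W₀, i₀, hi₀, hint, hlci, hcod, ⟨w₂, hw₂⟩, m, hm, u, hsupp, 0, 1, Fin.elim0, MvPolynomial.X j, Fin.elim0,
    Nat.one_pos, fun j' => j'.elim0, MvPolynomial.isHomogeneous_X ℂ j, fun j' => j'.elim0, ⟨w₂, hnotin⟩,
    fun j' => j'.elim0, fun j' => j'.elim0, fun j' => j'.elim0, ?_, W₀, i₀, hi₀, hlci, ?_, ?_, ?_, hsr, ?_⟩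
  · -- ambient clause: the patch set is empty
    rw [hPempty, classesSupportedOn_empty]
    exact bot_le
  · -- ideal clause: `⨅` over `Fin 0` is `⊤`
    rw [iInf_of_empty, inf_top_eq]
  · -- set clause
    rw [hPempty, Set.union_empty]
  · -- purity: every point specialises from the generic point, whose image has codimension `2`
    intro z
    exact ⟨genericPoint W₀, hcodξ, (genericPoint_specializes z).map i₀.base.hom.continuous⟩
  · -- component clause: the only component is `W₀`, carrying the non-zero class `m·a − φ^*u`
    intro z hz
    refine ⟨(m : ℂ), -u, ?_, ?_⟩
    · have hsub : Set.range i₀.base ⊆ closure {i₀.base z} := by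
        rintro _ ⟨w, rfl⟩
        exact specializes_iff_mem_closure.1 (hgen z hz w)
      have h := classesSupportedOn_mono hsub (2 * 2) hsupp
      simpa [map_neg, sub_eq_add_neg] using h
    · simpa [map_neg, sub_eq_add_neg] using hna u m hm

end Summit.HodgeConjecture.HodgeConjecture.Theorems

end
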